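import Summits.BirchSwinnertonDyer.BirchSwinnertonDyer.Theorems.PrintX9RescalingCompactSelmerDivision
import Literature.NumberTheory.EllipticCurves.SelmerTorsionInclusion
import Literature.NumberTheory.EllipticCurves.PointDivisibilityProofs
import HarnessLib

/-!
# `𝔖/p𝔖 ↪ ∏_n H¹(K_n, E[p])`: an element of `𝔖_p(K_∞) = lim←_n S_p(E/K_n)` all of whose mod-`p` components
# vanish is divisible by `p` in `𝔖` (helper for crux `PrintX10b.BeyondCarrierDepthX10b`,
# stmt-BirchSwinnertonDyer-23055, S1 = STUB 3 of the shared μ-item, COMPACT side; step (I2) of the rank-one route)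

Summits-side helper (`--supports stmt-BirchSwinnertonDyer-23055`); theorems only, no named fact, no `sorry`;
cohomological bookkeeping over the tree's definitions (`WeierstrassCurve.torsionH1Over`, `selmerTorsionOver`,
`compactSelmerOver`, `LambdaAdicSelmerData` of `HeegnerModuleIndex`; explicit cocycles of `ContinuousH1` /
`SelmerCorankProofs`), reusing `PrintX9Rescaling.exists_proj_eq_and_pow_smul_eq` (division by `p^a` in `𝔖` from
level-wise divisibility). Cell `pub/bsd-print-x9`, seat `bsd-line-x10b-p1-w2` g8 (memo
`HOME/x10b-p1-w2/S1-COKERNEL-BLUEPRINT-x10b-p1-w2-g8.md`, §1).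

WHAT (levels, any field `K`, any subgroup `H ≤ Γ_K`, `L = K̄^H`; the change-of-level map
`ι_k : H¹(H, E[p^k]) → H¹(H, E[p^{k+1}])` is `resH1Hom id (E[p^k] ↪ E[p^{k+1}])`, written out):
* §1 `reduceTorsionH1_incl` : `p_* (ι_k y) = p • y`; `pow_zsmulMap_eq_of_mem_compatiblePi` : for a `p_*`-compatible family
  `x`, `(p^k •)_* x_{k+1} = x_1` in `H¹(H, E[p])`; **`exists_incl_eq_of_mem_compatiblePi`** : if moreover `x_1 = 0` then
  `x_{k+1} = ι_k y` for some `y` (`p^k φ = ∂Q`, `Q = p^k Q'` in the divisible `E(K̄)`, `Q' ∈ E[p^{k+1}]`, and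
  `φ − ∂Q'` is `E[p^k]`-valued); **`incl_injective`** : `ι_k` is injective when `E(L)[p] = 0`; `incl_comm_reduce`.
* §2 (number field `K`, `H` normal) **`mem_selmerTorsionOver_iff_incl_mem`** : `y ∈ Sel^{(p^k)}(E/L) ↔ ι_k y ∈ Sel^{(p^{k+1})}(E/L)`
  (the local restriction maps to `H¹(H_{K_v}, E(K̄_v))` and the conjugations `conj_σ` commute with `ι_k`).
* §3 **`exists_mem_compactSelmerOver_smul_eq`** : a compact Selmer family `e ∈ S_p(E/L)` with `e_1 = 0` is `p • t` for a
  compact Selmer family `t` (when `E(L)[p] = 0`): `t_k := ι_k⁻¹(e_{k+1})`, compatible by injectivity of `ι`.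
* §4 **`LambdaAdicSelmerData.exists_natCast_smul_eq_of_forall_proj_one_eq_zero`** : for `e ∈ 𝔖` with `(proj n e) 1 = 0`
  for all `n` (and `E(K_n)[p] = 0` along the tower) there is `t ∈ 𝔖` with `(p : Λ) • t = e`; contrapositive
  `exists_proj_one_ne_zero_of_not_mem` : an `e ∉ p𝔖` has a non-zero mod-`p` component `e_{n,1} ∈ H¹(K_n, E[p])`.

WHY. In the rank-one route to the m-uniform cokernel bound of Howard's control map `𝔖 → H¹_{F_𝔮}(K, T_{𝔮_m})`
(memo §0; tree: p652328 `TowerPinnedLimitCokernelProofs`, p653099 `IwasawaAlgebraEisensteinRankOneCokernelProofs`) one needs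
ONE `e ∈ 𝔖` and ONE level `n₁` with `e_{n₁,1} ≠ 0`; by Nakayama (`𝔖 ≠ 0` finitely generated) some `e ∉ p𝔖` exists, and
this file converts `e ∉ p𝔖` into such an `n₁`. HONEST FRAMING: closes nothing by itself; no summit statement is proved;
BSD is not proved by any of this.

References: B. Perrin-Riou, Bull. SMF 115 (1987) §0 pp. 401–402; B. Howard, Compositio Math. 140 (2004) §2.2,
Lemma 2.2.7 / Prop. 2.2.8 and proof of Thm. 2.2.10; J. H. Silverman, *AEC* VIII.§2 (Kummer sequence), X.§4.
-/

set_option linter.dupNamespace false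
set_option autoImplicit false

noncomputable section

open scoped Classical

universe u

open WeierstrassCurve Literature.NumberTheory.EllipticCurves Literature.NumberTheory.GaloisRepresentations

namespace Summit.BirchSwinnertonDyer.BirchSwinnertonDyer.Theorems.PrintX10bModPDivision

/-! ## §1 The change-of-level maps `ι_k : H¹(H, E[p^k]) → H¹(H, E[p^{k+1}])`: explicit cocycles -/

section Level

variable {K : Type u} [Field K] (V : WeierstrassCurve K) (p : ℕ) [hp : Fact p.Prime]
  (H : Subgroup (Field.absoluteGaloisGroup K))

/-- The orbit map `σ ↦ σ • b` of a torsion point is continuous on a subgroup `H ≤ Γ_K` (discrete coefficients).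
[cite: SerreGaloisCohomology1997, Ch. II §1 (E(K̄) is a discrete Galois module)] -/
theorem continuous_subgroup_smul_geomTorsion (m : ℤ) (b : geomTorsion V m) :
    Continuous fun σ : H ↦ σ • b :=
  continuous_induced_rng.2 (by
    change Continuous fun σ : H ↦ ((σ • b : geomTorsion V m) : geomPoints V)
    simp only [Subgroup.smul_def, AddSubgroup.torsionBy.coe_smul]
    exact (V.continuous_smul_geomPoints (b : geomPoints V)).comp continuous_subtype_val)

omit hp in
/-- The inclusion `E[d] ↪ E[n]` (`d ∣ n`) is compatible with the action of `H` (the compatible pair `(id_H, incl)`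
defining the change-of-level map `H¹(H, E[d]) → H¹(H, E[n])`). [cite: SerreGaloisCohomology1997, Ch. I §2.4 (compatible pairs)] -/
theorem inclusion_id_smul {d n : ℤ} (h : d ∣ n) (x : H) (m : geomTorsion V d) :
    AddSubgroup.inclusion (V.geomTorsion_le_of_dvd h) (ContinuousMonoidHom.id H x • m) =
      x • AddSubgroup.inclusion (V.geomTorsion_le_of_dvd h) m :=
  rfl

omit hp in
/-- **`p_* ∘ ι_k = p`**: the transition map `p_* : H¹(H, E[p^{k+1}]) → H¹(H, E[p^k])` after the change of level
`ι_k : H¹(H, E[p^k]) → H¹(H, E[p^{k+1}])` is multiplication by `p` (the composite `E[p^k] ↪ E[p^{k+1}] →(p•) E[p^k]` is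
`p •`). [cite: PerrinRiou1987BSMF, §0 p. 401 (transition maps induced by multiplication by p)] -/
theorem reduceTorsionH1_incl (k : ℕ) (y : V.torsionH1Over ((p : ℤ) ^ k) H) :
    V.reduceTorsionH1 p k H
        (resH1Hom (ContinuousMonoidHom.id H)
          (AddSubgroup.inclusion (V.geomTorsion_le_of_dvd (pow_dvd_pow (p : ℤ) (Nat.le_add_right k 1))))
          (inclusion_id_smul V H (pow_dvd_pow (p : ℤ) (Nat.le_add_right k 1))) y) = (p : ℤ) • y := by
  obtain ⟨φ, rfl⟩ := oneCocycleClass_surjective _ y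
  rw [resH1Hom_id_oneCocycleClass]
  have hred : V.reduceTorsionH1 p k H (oneCocycleClass _ (contOneCocycles.push (G := H)
      (AddSubgroup.inclusion (V.geomTorsion_le_of_dvd (pow_dvd_pow (p : ℤ) (Nat.le_add_right k 1))))
      (inclusion_id_smul V H (pow_dvd_pow (p : ℤ) (Nat.le_add_right k 1))) φ)) =
      oneCocycleClass _ (contOneCocycles.push (G := H) (V.geomTorsionReduce p k) (fun τ P ↦
        Subtype.ext (by
          change (p : ℤ) • ((τ : Field.absoluteGaloisGroup K) • (P : geomPoints V)) =
            (τ : Field.absoluteGaloisGroup K) • ((p : ℤ) • (P : geomPoints V))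
          rw [smul_zsmul_geomPoints])) (contOneCocycles.push (G := H)
      (AddSubgroup.inclusion (V.geomTorsion_le_of_dvd (pow_dvd_pow (p : ℤ) (Nat.le_add_right k 1))))
      (inclusion_id_smul V H (pow_dvd_pow (p : ℤ) (Nat.le_add_right k 1))) φ)) :=
    resH1Hom_id_oneCocycleClass _ _ _
  have hsm := oneCocycleClass_smul (discreteTopRep H (geomTorsion V ((p : ℤ) ^ k))) (p : ℤ) φ
  conv at hsm => rhs; rw [Nat.cast_smul_eq_nsmul, ← natCast_zsmul]
  rw [hred, ← hsm]
  refine congrArg (oneCocycleClass _) (Subtype.ext (ContinuousMap.ext fun σ ↦ Subtype.ext ?_))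
  rw [contOneCocycles.push_apply, contOneCocycles.push_apply, Submodule.coe_smul, ContinuousMap.smul_apply]
  rfl

omit hp in
/-- **`ι` commutes with `p_*`**: `ι_k (p_* z) = p_* (ι_{k+1} z)` for `z ∈ H¹(H, E[p^{k+2}])` (both are induced by
`p • : E[p^{k+2}] → E[p^{k+1}]`). [cite: PerrinRiou1987BSMF, §0 p. 401 (transition maps induced by multiplication by p)] -/
theorem incl_reduceTorsionH1 (k : ℕ) (z : V.torsionH1Over ((p : ℤ) ^ (k + 1)) H) :
    resH1Hom (ContinuousMonoidHom.id H)
        (AddSubgroup.inclusion (V.geomTorsion_le_of_dvd (pow_dvd_pow (p : ℤ) (Nat.le_add_right k 1))))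
        (inclusion_id_smul V H (pow_dvd_pow (p : ℤ) (Nat.le_add_right k 1))) (V.reduceTorsionH1 p k H z) =
      V.reduceTorsionH1 p (k + 1) H
        (resH1Hom (ContinuousMonoidHom.id H)
          (AddSubgroup.inclusion (V.geomTorsion_le_of_dvd (pow_dvd_pow (p : ℤ) (Nat.le_add_right (k + 1) 1))))
          (inclusion_id_smul V H (pow_dvd_pow (p : ℤ) (Nat.le_add_right (k + 1) 1))) z) := by
  obtain ⟨φ, rfl⟩ := oneCocycleClass_surjective _ z
  have hred : V.reduceTorsionH1 p k H (oneCocycleClass _ φ) =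
      oneCocycleClass _ (contOneCocycles.push (G := H) (V.geomTorsionReduce p k) (fun τ P ↦
        Subtype.ext (by
          change (p : ℤ) • ((τ : Field.absoluteGaloisGroup K) • (P : geomPoints V)) =
            (τ : Field.absoluteGaloisGroup K) • ((p : ℤ) • (P : geomPoints V))
          rw [smul_zsmul_geomPoints])) φ) :=
    resH1Hom_id_oneCocycleClass _ _ φ
  rw [hred, resH1Hom_id_oneCocycleClass, resH1Hom_id_oneCocycleClass]
  have hred' : V.reduceTorsionH1 p (k + 1) H (oneCocycleClass _ (contOneCocycles.push (G := H)
      (AddSubgroup.inclusion (V.geomTorsion_le_of_dvd (pow_dvd_pow (p : ℤ) (Nat.le_add_right (k + 1) 1))))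
      (inclusion_id_smul V H (pow_dvd_pow (p : ℤ) (Nat.le_add_right (k + 1) 1))) φ)) =
      oneCocycleClass _ (contOneCocycles.push (G := H) (V.geomTorsionReduce p (k + 1)) (fun τ P ↦
        Subtype.ext (by
          change (p : ℤ) • ((τ : Field.absoluteGaloisGroup K) • (P : geomPoints V)) =
            (τ : Field.absoluteGaloisGroup K) • ((p : ℤ) • (P : geomPoints V))
          rw [smul_zsmul_geomPoints])) (contOneCocycles.push (G := H)
      (AddSubgroup.inclusion (V.geomTorsion_le_of_dvd (pow_dvd_pow (p : ℤ) (Nat.le_add_right (k + 1) 1))))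
      (inclusion_id_smul V H (pow_dvd_pow (p : ℤ) (Nat.le_add_right (k + 1) 1))) φ)) :=
    resH1Hom_id_oneCocycleClass _ _ _
  rw [hred']
  refine congrArg (oneCocycleClass _) (Subtype.ext (ContinuousMap.ext fun σ ↦ Subtype.ext ?_))
  rfl

omit hp in
/-- **The `k`-fold transition is `(p^k •)_*`**: for a `p_*`-compatible family `x ∈ ∏_j H¹(H, E[p^j])`,
`(p^k •)_* x_{k+1} = x_1` in `H¹(H, E[p])`, where `(p^k •)_*` is induced by `p^k • : E[p^{k+1}] → E[p]`
(`geomTorsionZSMul`). [cite: PerrinRiou1987BSMF, §0 p. 401 (S_p(L) = lim← along multiplication by p)] -/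
theorem pow_zsmulMap_eq_of_mem_compatiblePi {x : V.torsionH1Pi p H} (hx : x ∈ V.compatiblePi H p) (k : ℕ) :
    resH1Hom (ContinuousMonoidHom.id H)
        (V.geomTorsionZSMul (d := (p : ℤ) ^ 1) (n := (p : ℤ) ^ (k + 1)) ((p : ℤ) ^ k) (dvd_of_eq (by ring)))
        (fun σ P ↦ V.geomTorsionZSMul_smul _ _ (σ : Field.absoluteGaloisGroup K) P) (x (k + 1)) = x 1 := by
  induction k with
  | zero =>
    obtain ⟨φ, hφ⟩ := oneCocycleClass_surjective _ (x 1)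
    rw [← hφ, resH1Hom_id_oneCocycleClass]
    refine congrArg (oneCocycleClass _) (Subtype.ext (ContinuousMap.ext fun σ ↦ Subtype.ext ?_))
    rw [contOneCocycles.push_apply, coe_geomTorsionZSMul, pow_zero, one_smul]
  | succ k ih =>
    rw [← ih, ← (mem_compatiblePi_iff.1 hx) (k + 1)]
    obtain ⟨φ, hφ⟩ := oneCocycleClass_surjective _ (x (k + 1 + 1))
    have hred : V.reduceTorsionH1 p (k + 1) H (oneCocycleClass _ φ) =
        oneCocycleClass _ (contOneCocycles.push (G := H) (V.geomTorsionReduce p (k + 1)) (fun τ P ↦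
          Subtype.ext (by
            change (p : ℤ) • ((τ : Field.absoluteGaloisGroup K) • (P : geomPoints V)) =
              (τ : Field.absoluteGaloisGroup K) • ((p : ℤ) • (P : geomPoints V))
            rw [smul_zsmul_geomPoints])) φ) :=
      resH1Hom_id_oneCocycleClass _ _ φ
    rw [← hφ, hred, resH1Hom_id_oneCocycleClass, resH1Hom_id_oneCocycleClass]
    refine congrArg (oneCocycleClass _) (Subtype.ext (ContinuousMap.ext fun σ ↦ Subtype.ext ?_))
    rw [contOneCocycles.push_apply, contOneCocycles.push_apply, contOneCocycles.push_apply, coe_geomTorsionZSMul,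
      coe_geomTorsionZSMul, coe_geomTorsionReduce, smul_smul, ← pow_succ]

variable [V.IsElliptic]

/-- **Lifting along `ι_k` when the mod-`p` component vanishes.** If `x ∈ ∏_j H¹(H, E[p^j])` is `p_*`-compatible
and `x_1 = 0 ∈ H¹(H, E[p])`, then every `x_{k+1}` is in the image of `ι_k : H¹(H, E[p^k]) → H¹(H, E[p^{k+1}])`:
writing `x_{k+1} = [φ]`, `(p^k •)_*[φ] = x_1 = 0` gives `p^k φ = ∂Q` with `Q ∈ E[p]`; in the divisible group `E(K̄)`
pick `Q'` with `p^k Q' = Q`, so `Q' ∈ E[p^{k+1}]`, and `φ − ∂Q'` is an `E[p^k]`-valued cocycle in the class of `φ`.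
[cite: SilvermanAEC2009, VIII.§2 (exactness of 0 → E[m] → E(K̄) → E(K̄) → 0)]
[cite: PerrinRiou1987BSMF, §0 p. 401] -/
theorem exists_incl_eq_of_mem_compatiblePi {x : V.torsionH1Pi p H} (hx : x ∈ V.compatiblePi H p)
    (h1 : x 1 = 0) (k : ℕ) :
    ∃ y : V.torsionH1Over ((p : ℤ) ^ k) H,
      resH1Hom (ContinuousMonoidHom.id H)
        (AddSubgroup.inclusion (V.geomTorsion_le_of_dvd (pow_dvd_pow (p : ℤ) (Nat.le_add_right k 1))))
        (inclusion_id_smul V H (pow_dvd_pow (p : ℤ) (Nat.le_add_right k 1))) y = x (k + 1) := by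
  have hdiv : V.zsmul_geomPoints_surjective := V.zsmul_geomPoints_surjective_holds
  obtain ⟨φ, hφ⟩ := oneCocycleClass_surjective _ (x (k + 1))
  -- `(p^k •)_* [φ] = 0`: `p^k φ = ∂Q`, `Q ∈ E[p]`
  have h0 := pow_zsmulMap_eq_of_mem_compatiblePi V p H hx k
  rw [h1, ← hφ, resH1Hom_id_oneCocycleClass, oneCocycleClass_eq_zero_iff] at h0
  obtain ⟨Q, hQ⟩ := h0
  have hQ' : ∀ σ : H, ((p : ℤ) ^ k) • ((φ.1 σ : geomTorsion V ((p : ℤ) ^ (k + 1))) : geomPoints V) =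
      (σ : Field.absoluteGaloisGroup K) • (Q : geomPoints V) - Q := fun σ ↦ Subtype.ext_iff.1 (hQ σ)
  -- divide `Q` by `p^k` in `E(K̄)`: `Q' ∈ E[p^{k+1}]`
  obtain ⟨Q', hQ'Q⟩ := hdiv (pow_ne_zero k (Int.natCast_ne_zero.mpr hp.out.ne_zero)) (Q : geomPoints V)
  change ((p : ℤ) ^ k) • Q' = (Q : geomPoints V) at hQ'Q
  have hQ'mem : Q' ∈ geomTorsion V ((p : ℤ) ^ (k + 1)) := by
    rw [mem_geomTorsion_iff, pow_succ', mul_smul, hQ'Q]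
    have hQ1 := (mem_geomTorsion_iff V _ _).1 Q.2
    exact ((congrArg (· • (Q : geomPoints V)) (pow_one (p : ℤ))).symm.trans hQ1 :)
  set b : geomTorsion V ((p : ℤ) ^ (k + 1)) := ⟨Q', hQ'mem⟩ with hb
  -- `φ' = φ − ∂Q'` is `E[p^k]`-valued
  set φ' := φ - cobCocycle (G := H) b (continuous_subgroup_smul_geomTorsion V H _ b) with hφ'
  have hval : ∀ σ : H, ((p : ℤ) ^ k) • ((φ'.1 σ : geomTorsion V ((p : ℤ) ^ (k + 1))) : geomPoints V) = 0 := fun σ ↦ by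
    change ((p : ℤ) ^ k) • (((φ.1 σ - ((σ • b : geomTorsion V ((p : ℤ) ^ (k + 1))) - b) :
      geomTorsion V ((p : ℤ) ^ (k + 1))) : geomPoints V)) = 0
    rw [AddSubgroupClass.coe_sub, AddSubgroupClass.coe_sub, Subgroup.smul_def, AddSubgroup.torsionBy.coe_smul,
      smul_sub, hQ', smul_sub, ← smul_zsmul_geomPoints, hQ'Q, sub_self]
  have hmem : ∀ σ : H, ((φ'.1 σ : geomTorsion V ((p : ℤ) ^ (k + 1))) : geomPoints V) ∈ geomTorsion V ((p : ℤ) ^ k) :=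
    fun σ ↦ (mem_geomTorsion_iff V _ _).2 (hval σ)
  let χ : contOneCocycles (discreteTopRep H (geomTorsion V ((p : ℤ) ^ k))) :=
    contOneCocycles.lift (AddSubgroup.inclusion (V.geomTorsion_le_of_dvd (pow_dvd_pow (p : ℤ) (Nat.le_add_right k 1))))
      (inclusion_id_smul V H (pow_dvd_pow (p : ℤ) (Nat.le_add_right k 1))) (AddSubgroup.inclusion_injective _) φ' (fun σ ↦ ⟨_, hmem σ⟩) (fun _ ↦ rfl)
  refine ⟨oneCocycleClass _ χ, ?_⟩
  rw [resH1Hom_id_oneCocycleClass, contOneCocycles.push_lift, hφ', oneCocycleClass_sub, oneCocycleClass_cobCocycle,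
    sub_zero, hφ]

omit hp [V.IsElliptic] in
/-- **`ι_k` is injective when `E(L)[p] = 0`**: if `ι_k [χ] = 0`, i.e. `χ = ∂b` with `b ∈ E[p^{k+1}]`, then `p^k b` is fixed
by `H` (as `p^k χ = 0`) and killed by `p`, hence zero, so `b ∈ E[p^k]` and `[χ] = 0`.
[cite: SilvermanAEC2009, VIII.§2 and X.§4 (the Kummer sequence)] -/
theorem incl_injective (hnt : ∀ P ∈ V.fixedGeomPoints H, (p : ℤ) • P = 0 → P = 0) (k : ℕ) :
    Function.Injective (resH1Hom (ContinuousMonoidHom.id H)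
      (AddSubgroup.inclusion (V.geomTorsion_le_of_dvd (pow_dvd_pow (p : ℤ) (Nat.le_add_right k 1))))
      (inclusion_id_smul V H (pow_dvd_pow (p : ℤ) (Nat.le_add_right k 1))) : V.torsionH1Over ((p : ℤ) ^ k) H → V.torsionH1Over ((p : ℤ) ^ (k + 1)) H) := by
  rw [injective_iff_map_eq_zero]
  intro y hy
  obtain ⟨χ, rfl⟩ := oneCocycleClass_surjective _ y
  rw [resH1Hom_id_oneCocycleClass, oneCocycleClass_eq_zero_iff] at hy
  obtain ⟨b, hbχ⟩ := hy
  -- `χ σ = σ b − b` in `E(K̄)`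
  have hval : ∀ σ : H, ((χ.1 σ : geomTorsion V ((p : ℤ) ^ k)) : geomPoints V) =
      (σ : Field.absoluteGaloisGroup K) • (b : geomPoints V) - b := fun σ ↦ Subtype.ext_iff.1 (hbχ σ)
  -- `p^k b ∈ E(L)[p]`, hence `p^k b = 0`
  have hfix : ((p : ℤ) ^ k) • (b : geomPoints V) ∈ V.fixedGeomPoints H := by
    rw [mem_fixedGeomPoints_iff]
    intro σ hσ
    have h := (mem_geomTorsion_iff V _ _).1 (χ.1 ⟨σ, hσ⟩).2
    rw [hval ⟨σ, hσ⟩, zsmul_sub, sub_eq_zero, ← smul_zsmul_geomPoints] at h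
    exact h
  have hkill : (p : ℤ) • (((p : ℤ) ^ k) • (b : geomPoints V)) = 0 := by
    rw [smul_smul, ← pow_succ', ← mem_geomTorsion_iff]
    exact b.2
  have hb0 : ((p : ℤ) ^ k) • (b : geomPoints V) = 0 := hnt _ hfix hkill
  -- so `b ∈ E[p^k]` and `χ = ∂b` there
  rw [oneCocycleClass_eq_zero_iff]
  refine ⟨⟨(b : geomPoints V), (mem_geomTorsion_iff V _ _).2 hb0⟩, fun σ ↦ Subtype.ext ?_⟩
  rw [hval σ]
  rfl

end Level

/-! ## §2 `Sel^{(p^k)}(E/L) = ι_k⁻¹(Sel^{(p^{k+1})}(E/L))` -/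

section Selmer

variable {K : Type u} [Field K] [NumberField K] (V : WeierstrassCurve K) (p : ℕ)
  (H : Subgroup (Field.absoluteGaloisGroup K)) [H.Normal]

omit [NumberField K] [H.Normal] in
/-- The local restriction to `H¹(H_{K_v}, E(K̄_v))` does not see the level: `loc^{(p^{k+1})} ∘ ι_k = loc^{(p^k)}`
(both are induced by `E[p^k] ↪ E(K̄) → E(K̄_v)`). [cite: PerrinRiou1987BSMF, §0 p. 401 (Sel^{(p^n)} as a kernel into ∏ H¹(L_v, E))] -/
theorem localResTorsionOverOfEmb_incl {E : Type u} [Field E] [Algebra K E] (ι : AlgebraicClosure K →ₐ[K] AlgebraicClosure E)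
    (k : ℕ) (y : V.torsionH1Over ((p : ℤ) ^ k) H) :
    V.localResTorsionOverOfEmb ((p : ℤ) ^ (k + 1)) H ι
        (resH1Hom (ContinuousMonoidHom.id H)
          (AddSubgroup.inclusion (V.geomTorsion_le_of_dvd (pow_dvd_pow (p : ℤ) (Nat.le_add_right k 1))))
          (inclusion_id_smul V H (pow_dvd_pow (p : ℤ) (Nat.le_add_right k 1))) y) =
      V.localResTorsionOverOfEmb ((p : ℤ) ^ k) H ι y := by
  change ((V.localResTorsionOverOfEmb ((p : ℤ) ^ (k + 1)) H ι).comp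
    (resH1Hom (ContinuousMonoidHom.id H)
      (AddSubgroup.inclusion (V.geomTorsion_le_of_dvd (pow_dvd_pow (p : ℤ) (Nat.le_add_right k 1))))
      (inclusion_id_smul V H (pow_dvd_pow (p : ℤ) (Nat.le_add_right k 1))))) y = _
  rw [WeierstrassCurve.localResTorsionOverOfEmb, WeierstrassCurve.localResTorsionOverOfEmb, resH1Hom_comp]
  exact congrFun (congrArg DFunLike.coe (resH1Hom_congr (by ext; rfl) (by ext; rfl) _ _)) y

omit [NumberField K] in
/-- Conjugation commutes with the change of level: `conj_σ ∘ ι_k = ι_k ∘ conj_σ` (both composites are induced by the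
compatible pair `(h ↦ σ⁻¹ h σ, P ↦ σ • P)`). [cite: NeukirchSchmidtWingberg2008, I.§5 (functoriality of conjugation)] -/
theorem conjH1_incl (σ : Field.absoluteGaloisGroup K) (k : ℕ) (y : V.torsionH1Over ((p : ℤ) ^ k) H) :
    Literature.NumberTheory.EllipticCurves.conjH1 H (geomTorsion V ((p : ℤ) ^ (k + 1))) σ
        (resH1Hom (ContinuousMonoidHom.id H)
          (AddSubgroup.inclusion (V.geomTorsion_le_of_dvd (pow_dvd_pow (p : ℤ) (Nat.le_add_right k 1))))
          (inclusion_id_smul V H (pow_dvd_pow (p : ℤ) (Nat.le_add_right k 1))) y) =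
      resH1Hom (ContinuousMonoidHom.id H)
        (AddSubgroup.inclusion (V.geomTorsion_le_of_dvd (pow_dvd_pow (p : ℤ) (Nat.le_add_right k 1))))
        (inclusion_id_smul V H (pow_dvd_pow (p : ℤ) (Nat.le_add_right k 1))) (Literature.NumberTheory.EllipticCurves.conjH1 H (geomTorsion V ((p : ℤ) ^ k)) σ y) := by
  change ((Literature.NumberTheory.EllipticCurves.conjH1 H (geomTorsion V ((p : ℤ) ^ (k + 1))) σ).comp
      (resH1Hom (ContinuousMonoidHom.id H)
        (AddSubgroup.inclusion (V.geomTorsion_le_of_dvd (pow_dvd_pow (p : ℤ) (Nat.le_add_right k 1))))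
        (inclusion_id_smul V H (pow_dvd_pow (p : ℤ) (Nat.le_add_right k 1))))) y =
    ((resH1Hom (ContinuousMonoidHom.id H)
        (AddSubgroup.inclusion (V.geomTorsion_le_of_dvd (pow_dvd_pow (p : ℤ) (Nat.le_add_right k 1))))
        (inclusion_id_smul V H (pow_dvd_pow (p : ℤ) (Nat.le_add_right k 1)))).comp
      (Literature.NumberTheory.EllipticCurves.conjH1 H (geomTorsion V ((p : ℤ) ^ k)) σ)) y
  rw [Literature.NumberTheory.EllipticCurves.conjH1, Literature.NumberTheory.EllipticCurves.conjH1, resH1Hom_comp,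
    resH1Hom_comp]
  exact congrFun (congrArg DFunLike.coe (resH1Hom_congr (by ext; rfl) (by ext; rfl) _ _)) y

/-- **`Sel^{(p^k)}(E/L) = ι_k⁻¹(Sel^{(p^{k+1})}(E/L))`**: a class `y ∈ H¹(H, E[p^k])` is Selmer iff `ι_k y` is (the
defining local conditions «`conj_σ y` dies in `H¹(H_{K_v}, E(K̄_v))`» are read through maps that do not see the level).
[cite: PerrinRiou1987BSMF, §0 p. 401 (Sel^{(p^n)}(E/L) = ker(H¹(L, E_{p^n}) → ∏_v H¹(L_v, E)))] -/
theorem mem_selmerTorsionOver_iff_incl_mem (k : ℕ) (y : V.torsionH1Over ((p : ℤ) ^ k) H) :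
    y ∈ V.selmerTorsionOver H ((p : ℤ) ^ k) ↔
      resH1Hom (ContinuousMonoidHom.id H)
          (AddSubgroup.inclusion (V.geomTorsion_le_of_dvd (pow_dvd_pow (p : ℤ) (Nat.le_add_right k 1))))
          (inclusion_id_smul V H (pow_dvd_pow (p : ℤ) (Nat.le_add_right k 1))) y ∈ V.selmerTorsionOver H ((p : ℤ) ^ (k + 1)) := by
  simp only [WeierstrassCurve.selmerTorsionOver, AddSubgroup.mem_inf, AddSubgroup.mem_iInf, AddSubgroup.mem_comap,
    AddMonoidHom.mem_ker, conjH1_incl, localResTorsionOverOfEmb_incl]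

end Selmer

/-! ## §3 Division by `p` in the compact Selmer group `S_p(E/L)` -/

section Compact

variable {K : Type u} [Field K] [NumberField K] (V : WeierstrassCurve K) [V.IsElliptic] (p : ℕ) [hp : Fact p.Prime]
  (H : Subgroup (Field.absoluteGaloisGroup K)) [H.Normal]

/-- **A compact Selmer family with vanishing mod-`p` component is divisible by `p` in `S_p(E/L)`** (`E(L)[p] = 0`):
for `e ∈ S_p(E/L) ⊆ ∏_k H¹(H, E[p^k])` with `e_1 = 0` there is `t ∈ S_p(E/L)` with `p • t = e`. Construction:
`t_k := ι_k⁻¹(e_{k+1})` (§1), Selmer by §2, `p_*`-compatible because `ι_k` is injective and commutes with `p_*`, and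
`p • t_k = p_*(ι_k t_k) = p_* e_{k+1} = e_k`. [cite: PerrinRiou1987BSMF, §0 p. 401 (S_p(L) = lim← S(L)^{(p^n)})]
[cite: SilvermanAEC2009, VIII.§2] -/
theorem exists_mem_compactSelmerOver_smul_eq (hnt : ∀ P ∈ V.fixedGeomPoints H, (p : ℤ) • P = 0 → P = 0)
    {e : V.torsionH1Pi p H} (he : e ∈ V.compactSelmerOver H p) (h1 : e 1 = 0) :
    ∃ t : V.torsionH1Pi p H, t ∈ V.compactSelmerOver H p ∧ (p : ℤ) • t = e := by
  have hec : e ∈ V.compatiblePi H p := PrintX9Rescaling.compatiblePi_of_mem_compactSelmerOver V p H he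
  have hesel := ((V.mem_compactSelmerOver_iff H p e).1 he).1
  have hered := ((V.mem_compactSelmerOver_iff H p e).1 he).2
  choose t ht using fun k ↦ exists_incl_eq_of_mem_compatiblePi V p H hec h1 k
  refine ⟨t, (V.mem_compactSelmerOver_iff H p t).2 ⟨fun k ↦ ?_, fun k ↦ ?_⟩, funext fun k ↦ ?_⟩
  · -- Selmer
    rw [mem_selmerTorsionOver_iff_incl_mem V p H k, ht k]
    exact hesel (k + 1)
  · -- `p_*`-compatible, by injectivity of `ι_k`
    apply incl_injective V p H hnt k
    rw [ht k, incl_reduceTorsionH1 V p H k, ht (k + 1)]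
    exact hered (k + 1)
  · -- `p • t_k = e_k`
    rw [Pi.smul_apply, ← reduceTorsionH1_incl V p H k (t k), ht k]
    exact hered k

end Compact

/-! ## §4 Division by `p` in `𝔖_p(K_∞)`: `𝔖/p𝔖 ↪ ∏_n H¹(K_n, E[p])` -/

section LambdaAdic

variable {K : Type u} [Field K] [NumberField K] {V : WeierstrassCurve K} [V.IsElliptic] {p : ℕ} [hp : Fact p.Prime]
  {κ : ZpExtension K p} {γ : Field.absoluteGaloisGroup K}

/-- **`𝔖/p𝔖 ↪ ∏_n H¹(K_n, E[p])`.** Let `E(K_n)[p] = 0` along the tower. If `e ∈ 𝔖 = lim←_n S_p(E/K_n)` has all its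
mod-`p` components `e_{n,1} = (proj n e) 1 ∈ H¹(K_n, E[p])` equal to zero, then `e = p • t` for some `t ∈ 𝔖`: level-wise
`proj n e = p • t_n` with `t_n ∈ S_p(E/K_n)` (§3), and the tree's `PrintX9Rescaling.exists_proj_eq_and_pow_smul_eq` glues the
`t_n` (their norm defect is a compatible family killed by `p`, hence zero). Step (I2) of the rank-one route to the
m-uniform cokernel bound of Howard's control map. [cite: PerrinRiou1987BSMF, §0 p. 402 (𝔖_p = lim← S_p(K_n))]
[cite: Howard2004HeegnerKolyvagin, Lemma 2.2.7 / Prop. 2.2.8 and proof of Thm. 2.2.10 (𝔮 = T^m + p)] -/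
theorem exists_natCast_smul_eq_of_forall_proj_one_eq_zero (D : V.LambdaAdicSelmerData κ γ)
    (hnt : ∀ n, ∀ P ∈ V.fixedGeomPoints (κ.layerSubgroup n), (p : ℤ) • P = 0 → P = 0)
    (e : D.S) (he : ∀ n, D.proj n e 1 = 0) :
    ∃ t : D.S, (p : IwasawaAlgebra p) • t = e := by
  choose t ht using fun n ↦
    PrintX10bModPDivision.exists_mem_compactSelmerOver_smul_eq V p (κ.layerSubgroup n) (hnt n) (D.proj_mem n e) (he n)
  obtain ⟨s', -, hs'⟩ := PrintX9Rescaling.exists_proj_eq_and_pow_smul_eq D hnt 1 e t (fun n ↦ (ht n).1)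
    (fun n ↦ by rw [pow_one]; exact (ht n).2)
  exact ⟨s', by rw [← hs', pow_one]⟩

/-- **Contrapositive**: an element of `𝔖` NOT divisible by `p` has a non-zero mod-`p` component
`e_{n,1} ∈ H¹(K_n, E[p])` at some layer `n` (under `E(K_n)[p] = 0` along the tower).
[cite: PerrinRiou1987BSMF, §0 p. 402] [cite: Howard2004HeegnerKolyvagin, proof of Thm. 2.2.10 (𝔮 = T^m + p)] -/
theorem exists_proj_one_ne_zero_of_forall_smul_ne (D : V.LambdaAdicSelmerData κ γ)
    (hnt : ∀ n, ∀ P ∈ V.fixedGeomPoints (κ.layerSubgroup n), (p : ℤ) • P = 0 → P = 0)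
    (e : D.S) (he : ∀ t : D.S, (p : IwasawaAlgebra p) • t ≠ e) :
    ∃ n, D.proj n e 1 ≠ 0 := by
  by_contra h
  have h' : ∀ n, D.proj n e 1 = 0 := fun n ↦ by_contra fun hn ↦ h ⟨n, hn⟩
  obtain ⟨t, ht⟩ := exists_natCast_smul_eq_of_forall_proj_one_eq_zero D hnt e h'
  exact he t ht

/-- **Submodule form**: `e ∉ p𝔖` (the submodule `(p) • ⊤`) has a non-zero mod-`p` component at some layer. With
Nakayama (`𝔖 ≠ 0` finitely generated ⇒ `𝔖 ≠ p𝔖`) this produces the element `e` and the level `n₁` of the rank-one route.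
[cite: Howard2004HeegnerKolyvagin, proof of Thm. 2.2.10 (𝔮 = T^m + p)] -/
theorem exists_proj_one_ne_zero_of_not_mem (D : V.LambdaAdicSelmerData κ γ)
    (hnt : ∀ n, ∀ P ∈ V.fixedGeomPoints (κ.layerSubgroup n), (p : ℤ) • P = 0 → P = 0)
    (e : D.S) (he : e ∉ (Ideal.span {(p : IwasawaAlgebra p)} • ⊤ : Submodule (IwasawaAlgebra p) D.S)) :
    ∃ n, D.proj n e 1 ≠ 0 := by
  refine exists_proj_one_ne_zero_of_forall_smul_ne D hnt e fun t ht ↦ he ?_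
  rw [← ht, Submodule.ideal_span_singleton_smul, Submodule.mem_smul_pointwise_iff_exists]
  exact ⟨t, Submodule.mem_top, rfl⟩

end LambdaAdic

end Summit.BirchSwinnertonDyer.BirchSwinnertonDyer.Theorems.PrintX10bModPDivision

end
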